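import Summits.AtomisticToContinuum.FouriersLaw.Theses.VanishingNoiseTransfer
import Summits.AtomisticToContinuum.FouriersLaw.Theorems.OddSectorIrreversibilityResponseDensityLeOne
import Literature.MathematicalPhysics.KineticTheory.VelocityFlipNoise

/-!
# Response density of the flip-noisy steady family: the cases `N ≤ 1` and the identification of
`μ T T` (helpers for stub `stub_responseDensityNoisy`)

Helper file `--supports stmt-AtomisticToContinuum-11975` (crux `NoiseLocality`, route
`VanishingNoiseTransfer`, line `relative-flip-energy-transfer`, stub 1b `stub_responseDensityNoisy`).

The stub asks, for the unique weak steady family `μ T_L T_R` of the velocity-flip perturbation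
`L + εS` (`OscillatorChain.IsFlipSteadyState`, rate `ε > 0`) of the `N`-chain and `T > 0`, for an
`L²(μ_T)` RESPONSE DENSITY `U` (`μ_T = gibbsMeasure N T`):
`d/dδ ∫ g dμ_{T+δ/2,T-δ/2} |₀ = ∫ g U dμ_T` for every `g ∈ C_c^∞` (as a `HasDerivAt` at `0`) and the
same for the total current. This file proves, sorry-free and for EVERY rate `ε`:

* `flipGenerator_eq_of_le_one`, `isFlipSteadyState_iff_of_le_one` — for a chain with at most one
  site the flip-noisy generator `L_{T_L,T_R} + εS`, hence the flip steady-state condition, depends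
  on the bath temperatures only through `T_L + T_R` (both baths act on the single momentum; the
  flip part does not involve the temperatures at all);
* `of_le_one` — the stub's conclusion for EVERY oscillator chain with `N ≤ 1`, every rate `ε`,
  with `U = 0`: by uniqueness at `(T, T)`, `μ_{T+δ/2,T-δ/2} = μ_{T,T}` for `|δ| < 2T`
  (`flipSteadyFamily_eventuallyEq_nhds_of_le_one`), so everything to be differentiated is constant
  near `δ = 0`;
* `flipSteadyFamily_eq_gibbsMeasure` — for the pinned chain, under uniqueness of the flip steady
  state at `(T, T)`, `μ T T` IS the Gibbs measure (`pinnedChain_isFlipSteadyState_gibbsMeasure`: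
  the Gibbs measure is a flip steady state at every rate);
* `helper_responseDensityNoisyLeOne` — the registered helper sub-goal (= `of_le_one` in stub form).

No definitions.
-/

noncomputable section

open MeasureTheory Filter Topology
open scoped ContDiff

namespace Summit.AtomisticToContinuum.FouriersLaw.Theorems.NoiseLocality.StubResponseDensityNoisy

open Literature.MathematicalPhysics.KineticTheory.HeatConduction

/-! ### `N ≤ 1`: the flip-noisy generator only sees `T_L + T_R` -/

/-- For `N ≤ 1` the flip-noisy generator `L_{T_L,T_R} f + ε S f` depends on the bath temperatures
only through their sum (the deterministic part does, `generator_eq_of_le_one`, and the flip part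
`ε ∑_i (f ∘ Θ_i - f)` does not involve them). -/
theorem flipGenerator_eq_of_le_one (P : OscillatorChain) {N : ℕ} (hN : N ≤ 1)
    {T_L T_R T_L' T_R' : ℝ} (h : T_L + T_R = T_L' + T_R') (ε : ℝ) :
    P.flipGenerator N T_L T_R ε = P.flipGenerator N T_L' T_R' ε := by
  funext f x
  simp only [OscillatorChain.flipGenerator, generator_eq_of_le_one P hN h]

/-- For `N ≤ 1`, being a weak steady state of `L + εS` at `(T_L, T_R)` only depends on
`T_L + T_R` (every rate `ε`). -/
theorem isFlipSteadyState_iff_of_le_one (P : OscillatorChain) {N : ℕ} (hN : N ≤ 1)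
    {T_L T_R T_L' T_R' : ℝ} (h : T_L + T_R = T_L' + T_R') (ε : ℝ) (μ : Measure (PhaseSpace N)) :
    P.IsFlipSteadyState N T_L T_R ε μ ↔ P.IsFlipSteadyState N T_L' T_R' ε μ := by
  unfold OscillatorChain.IsFlipSteadyState
  rw [flipGenerator_eq_of_le_one P hN h ε]

/-- For a chain with at most one site, `T > 0`, a rate `ε`, and a family `μ` of weak flip steady
states that is unique at `(T, T)`: `μ (T + δ/2) (T - δ/2) = μ T T` for all `|δ| < 2T`, hence
eventually along `𝓝 0`. -/
theorem flipSteadyFamily_eventuallyEq_nhds_of_le_one (P : OscillatorChain) {N : ℕ} (hN : N ≤ 1)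
    {T : ℝ} (hT : 0 < T) (ε : ℝ) (μ : ℝ → ℝ → Measure (PhaseSpace N))
    (hμ : ∀ T_L T_R : ℝ, 0 < T_L → 0 < T_R →
      P.IsFlipSteadyState N T_L T_R ε (μ T_L T_R) ∧
        ∀ ν : Measure (PhaseSpace N), P.IsFlipSteadyState N T_L T_R ε ν → ν = μ T_L T_R) :
    ∀ᶠ δ in 𝓝 (0 : ℝ), μ (T + δ / 2) (T - δ / 2) = μ T T := by
  have hball : ∀ᶠ δ in 𝓝 (0 : ℝ), |δ| < 2 * T := by
    have : Metric.ball (0 : ℝ) (2 * T) ∈ 𝓝 (0 : ℝ) := Metric.ball_mem_nhds 0 (by positivity)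
    filter_upwards [this] with δ hδ
    simpa [Real.dist_eq] using hδ
  filter_upwards [hball] with δ hδ
  have h1 : 0 < T + δ / 2 := by
    have := neg_abs_le δ
    linarith
  have h2 : 0 < T - δ / 2 := by
    have := le_abs_self δ
    linarith
  have hst : P.IsFlipSteadyState N T T ε (μ (T + δ / 2) (T - δ / 2)) :=
    (isFlipSteadyState_iff_of_le_one P hN (by ring) ε _).mp (hμ _ _ h1 h2).1
  exact (hμ T T hT hT).2 _ hst

/-- **The stub for `N ≤ 1` (any oscillator chain, any rate `ε`), with response density `U = 0`.**
If the weak flip steady family `μ` is unique at every pair of positive bath temperatures (only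
uniqueness at `(T, T)` and steadiness near it are used) and `T > 0`, then `U = 0` is
square-integrable for the Gibbs measure, and `δ ↦ ∫ g dμ_{T+δ/2,T-δ/2}` (every observable `g`) and
`δ ↦ totalCurrent μ_{T+δ/2,T-δ/2}` are constant near `δ = 0`, so they have derivative
`0 = ∫ g · 0 dμ_T = ∑_i ∫ j_i · 0 dμ_T` there. -/
theorem of_le_one (P : OscillatorChain) {N : ℕ} (hN : N ≤ 1) {T : ℝ} (hT : 0 < T) (ε : ℝ)
    (μ : ℝ → ℝ → Measure (PhaseSpace N))
    (hμ : ∀ T_L T_R : ℝ, 0 < T_L → 0 < T_R →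
      P.IsFlipSteadyState N T_L T_R ε (μ T_L T_R) ∧
        ∀ ν : Measure (PhaseSpace N), P.IsFlipSteadyState N T_L T_R ε ν → ν = μ T_L T_R) :
    ∃ U : PhaseSpace N → ℝ,
      MemLp U 2 (P.gibbsMeasure N T) ∧
        (∀ g : PhaseSpace N → ℝ, ContDiff ℝ ((⊤ : ℕ∞) : WithTop ℕ∞) g → HasCompactSupport g →
            HasDerivAt (fun δ : ℝ => ∫ x, g x ∂(μ (T + δ / 2) (T - δ / 2)))
              (∫ x, g x * U x ∂(P.gibbsMeasure N T)) 0) ∧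
        HasDerivAt (fun δ : ℝ => P.totalCurrent (μ (T + δ / 2) (T - δ / 2)))
          (∑ i : Fin N, ∫ x, P.bondCurrent N i x * U x ∂(P.gibbsMeasure N T)) 0 := by
  have hev := flipSteadyFamily_eventuallyEq_nhds_of_le_one P hN hT ε μ hμ
  refine ⟨0, MemLp.zero, fun g _ _ => ?_, ?_⟩
  · simp only [Pi.zero_apply, mul_zero, integral_zero]
    refine (hasDerivAt_const (0 : ℝ) (∫ x, g x ∂(μ T T))).congr_of_eventuallyEq ?_
    filter_upwards [hev] with δ hδ
    rw [hδ]
  · simp only [Pi.zero_apply, mul_zero, integral_zero, Finset.sum_const_zero]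
    refine (hasDerivAt_const (0 : ℝ) (P.totalCurrent (μ T T))).congr_of_eventuallyEq ?_
    filter_upwards [hev] with δ hδ
    rw [hδ]

/-! ### The pinned chain: identification of `μ T T` with the Gibbs measure -/

/-- Under uniqueness of the weak flip steady state at `(T, T)` (`T > 0`, any rate `ε`), the
flip-noisy steady family of `pinnedChain ω₂ lam β γ` (`ω₂ > 0`, `lam, β ≥ 0`) passes through the
Gibbs measure: `μ T T = gibbsMeasure N T` (`pinnedChain_isFlipSteadyState_gibbsMeasure`: the Gibbs
measure is flip-invariant and steady for `L`, hence a flip steady state at every rate). -/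
theorem flipSteadyFamily_eq_gibbsMeasure {ω₂ lam β : ℝ} (hω : 0 < ω₂) (hl : 0 ≤ lam) (hβ : 0 ≤ β)
    (γ : ℝ) {N : ℕ} {T : ℝ} (hT : 0 < T) (ε : ℝ) (μ : ℝ → ℝ → Measure (PhaseSpace N))
    (hμ : ∀ T_L T_R : ℝ, 0 < T_L → 0 < T_R →
      (pinnedChain ω₂ lam β γ).IsFlipSteadyState N T_L T_R ε (μ T_L T_R) ∧
        ∀ ν : Measure (PhaseSpace N),
          (pinnedChain ω₂ lam β γ).IsFlipSteadyState N T_L T_R ε ν → ν = μ T_L T_R) :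
    μ T T = (pinnedChain ω₂ lam β γ).gibbsMeasure N T :=
  ((hμ T T hT hT).2 _ (pinnedChain_isFlipSteadyState_gibbsMeasure hω hl hβ γ N hT ε)).symm

/-- In particular `μ T T` is flip-invariant under each `Θ_i` and a probability measure steady for
`L_{T,T} + ε' S` at EVERY rate `ε'` (not only the family's own rate). -/
theorem flipSteadyFamily_isFlipSteadyState_diag {ω₂ lam β : ℝ} (hω : 0 < ω₂) (hl : 0 ≤ lam)
    (hβ : 0 ≤ β) (γ : ℝ) {N : ℕ} {T : ℝ} (hT : 0 < T) (ε ε' : ℝ)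
    (μ : ℝ → ℝ → Measure (PhaseSpace N))
    (hμ : ∀ T_L T_R : ℝ, 0 < T_L → 0 < T_R →
      (pinnedChain ω₂ lam β γ).IsFlipSteadyState N T_L T_R ε (μ T_L T_R) ∧
        ∀ ν : Measure (PhaseSpace N),
          (pinnedChain ω₂ lam β γ).IsFlipSteadyState N T_L T_R ε ν → ν = μ T_L T_R) :
    (∀ i : Fin N, MeasurePreserving (momentumFlip i) (μ T T) (μ T T)) ∧
      (pinnedChain ω₂ lam β γ).IsFlipSteadyState N T T ε' (μ T T) := by
  rw [flipSteadyFamily_eq_gibbsMeasure hω hl hβ γ hT ε μ hμ]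
  exact ⟨fun i => (pinnedChain ω₂ lam β γ).measurePreserving_momentumFlip_gibbsMeasure N T i,
    pinnedChain_isFlipSteadyState_gibbsMeasure hω hl hβ γ N hT ε'⟩

/-! ### Registered helper sub-goal (stub form, one line) -/

/-- Registered helper sub-goal `helper_responseDensityNoisyLeOne` of stub `stub_responseDensityNoisy`
(= `of_le_one` in stub form): the stub's conclusion for every chain with at most one site and every
flip rate, `U = 0`. -/
theorem helper_responseDensityNoisyLeOne : ∀ (P : Literature.MathematicalPhysics.KineticTheory.HeatConduction.OscillatorChain) (N : ℕ), N ≤ 1 → ∀ (T : ℝ), 0 < T → ∀ (ε : ℝ) (μ : ℝ → ℝ → MeasureTheory.Measure (Literature.MathematicalPhysics.KineticTheory.HeatConduction.PhaseSpace N)), (∀ T_L T_R : ℝ, 0 < T_L → 0 < T_R → P.IsFlipSteadyState N T_L T_R ε (μ T_L T_R) ∧ ∀ ν : MeasureTheory.Measure (Literature.MathematicalPhysics.KineticTheory.HeatConduction.PhaseSpace N), P.IsFlipSteadyState N T_L T_R ε ν → ν = μ T_L T_R) → ∃ U : Literature.MathematicalPhysics.KineticTheory.HeatConduction.PhaseSpace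 N → ℝ, MeasureTheory.MemLp U 2 (P.gibbsMeasure N T) ∧ (∀ g : Literature.MathematicalPhysics.KineticTheory.HeatConduction.PhaseSpace N → ℝ, ContDiff ℝ ((⊤ : ℕ∞) : WithTop ℕ∞) g → HasCompactSupport g → HasDerivAt (fun δ : ℝ => ∫ x, g x ∂(μ (T + δ / 2) (T - δ / 2))) (∫ x, g x * U x ∂(P.gibbsMeasure N T)) 0) ∧ HasDerivAt (fun δ : ℝ => P.totalCurrent (μ (T + δ / 2) (T - δ / 2))) (∑ i : Fin N, ∫ x, P.bondCurrent N i x * U x ∂(P.gibbsMeasure N T)) 0 :=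
  fun P _ hN _ hT ε μ hμ => of_le_one P hN hT ε μ hμ

end Summit.AtomisticToContinuum.FouriersLaw.Theorems.NoiseLocality.StubResponseDensityNoisy

end
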